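import Summits.BirchSwinnertonDyer.Rank1Residual.X11b.PrimaryInclusionLevels
import Literature.NumberTheory.EllipticCurves.LocalKummerSequenceSurjective
import Literature.NumberTheory.EllipticCurves.LocalEulerCharacteristicTorsion
import Literature.NumberTheory.EllipticCurves.TamagawaSubgroupProofs
import Literature.NumberTheory.EllipticCurves.LeadingTerm
import Literature.NumberTheory.EllipticCurves.TamagawaFiniteIndexProofs
import HarnessLib

/-!
# HT-C6 (B2 Tamagawa splitting), tool file 2/3: the local index `[𝓚_J(ℓ) : Kum_J(ℓ)] = #ker(res_tower)`, no fixed points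
# in `W[p^∞]` from no `p`-torsion at one completion, and the Tamagawa product as a finite product (crux
# `SupersingularRankZeroAtTwo` = stmt-BirchSwinnertonDyer-19097, line `odd_blind_package`, slot 5 CDC_H, glue binder hB2; cell
# `bsd-2adic`, seat `bsd-2adic-t42` GEN 41)

THEOREMS ONLY (no definition, no named fact, no instance, no `sorry`); `--supports stmt-BirchSwinnertonDyer-19097 --as
helper`; generic (`K` a number field / `ℚ`, any `W`, any level); closes nothing; BSD is proved for no curve.

* §1 `natCard_comap_eq_card_ker_mul` (groups) and **`natCard_comap_map_torsionPointsMap_eq`**: for a subgroup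
  `𝒦 ≤ H¹(K_ℓ, W)` killed by `n`, the preimage `H¹(i_n)⁻¹(𝒦) ≤ H¹(K_ℓ, W[n])` has order `#𝓛_ℓ · #𝒦` (`𝓛_ℓ = ker H¹(i_n)` the
  Kummer condition; `im H¹(i_n) = H¹(K_ℓ, W)[n] ⊇ 𝒦`, tree `range_map_torsionPointsMapIntertwining`); `comap … ⊥ = 𝓛_ℓ`.
* §2 `geomPrimaryTorsion_eq_zero_of_fixed_of_adicCompletion` — `W(K_v)[p] = 0 ⟹` no `Γ_K`-fixed point in `W[p^∞]`
  (Milne I §3 `H⁰(K_v, A_n) = A(K_v)_n`; route-free re-derivation of t42 GEN 40's `…_of_fixed_adicCompletion`).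
* §3 `tamagawaProduct_eq_prod_of_subset` / `two_pow_padicValNat_tamagawaProduct_eq_prod` — `Tam(W) = ∏_{v ∈ S_f} c_v` over
  any finite set of finite places containing the bad ones, and `p^{v_p Tam} = ∏_{v∈S_f} p^{v_p c_v}`.

References: [SilvermanAEC2009] X.§4 diagram (**), VII.6; [MilneADT2006] I Lemma 3.3; [GreenbergLNM1716] §2 p. 63, §3 Lemma 3.3.
-/

set_option autoImplicit false
set_option linter.dupNamespace false

noncomputable section

open scoped Classical NumberField ContRepresentation

namespace Summit.BirchSwinnertonDyer.BirchSwinnertonDyer.Theorems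

namespace FlatBlindTamagawaSplitting

open NumberField IsDedekindDomain Field WeierstrassCurve Literature.NumberTheory.EllipticCurves
  Literature.NumberTheory.GaloisRepresentations
open Summit.BirchSwinnertonDyer.Rank1Residual.X11b

universe u

/-! ## §1 The order of a preimage: `#f⁻¹(𝒦) = #ker f · #𝒦` for `𝒦 ≤ im f` -/

/-- **`#f⁻¹(𝒦) = #ker f · #𝒦`** for an additive map `f : A → B` and a subgroup `𝒦 ≤ im f` (the restriction
`f⁻¹(𝒦) → 𝒦` is onto with kernel `ker f`). [folklore] -/
theorem natCard_comap_eq_card_ker_mul {A B : Type*} [AddCommGroup A] [AddCommGroup B] (f : A →+ B)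
    (𝒦 : AddSubgroup B) (h𝒦 : 𝒦 ≤ f.range) :
    Nat.card (𝒦.comap f) = Nat.card f.ker * Nat.card 𝒦 := by
  set g : 𝒦.comap f →+ B := f.comp (𝒦.comap f).subtype with hg
  have hrange : g.range = 𝒦 := by
    ext y
    constructor
    · rintro ⟨x, rfl⟩
      exact x.2
    · intro hy
      obtain ⟨a, rfl⟩ := h𝒦 hy
      exact ⟨⟨a, hy⟩, rfl⟩
  have hle : f.ker ≤ 𝒦.comap f := fun a ha ↦ by
    rw [AddSubgroup.mem_comap, (AddMonoidHom.mem_ker).1 ha]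
    exact 𝒦.zero_mem
  have hker : g.ker = (f.ker).addSubgroupOf (𝒦.comap f) := by
    ext x
    rw [AddMonoidHom.mem_ker, AddSubgroup.mem_addSubgroupOf, AddMonoidHom.mem_ker]
    rfl
  rw [← AddSubgroup.card_mul_index g.ker, AddSubgroup.index_ker g, hrange, hker,
    Nat.card_congr (AddSubgroup.addSubgroupOfEquivOfLe hle).toEquiv]

section LocalIndex

variable {K : Type u} [Field K] [NumberField K] (W : WeierstrassCurve K) [W.IsElliptic]
  (ℓ : HeightOneSpectrum (𝓞 K))

/-- **`#H¹(i_n)⁻¹(𝒦) = #𝓛_ℓ · #𝒦` at a completion `K_ℓ`** for a subgroup `𝒦 ≤ H¹(K_ℓ, W)` killed by `n ≠ 0`: `H¹(i_n)`,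
`i_n : W[n] ↪ W(K̄_ℓ)`, has kernel the local Kummer condition `𝓛_ℓ = kummerLocalConditionAt` (by definition) and image
`H¹(K_ℓ, W)[n] ⊇ 𝒦` (Kummer sequence, `range_map_torsionPointsMapIntertwining`). (CDC road: `𝒦 = ker(res_tower)`,
`H¹(i_n)⁻¹(𝒦) = 𝓚_J(ℓ)`, the transported twisted Kummer kernel at `ℓ ≠ v`.) [cite: SilvermanAEC2009, X.§4 diagram (**)]
[cite: GreenbergLNM1716, §3 Lemma 3.3] -/
theorem natCard_comap_map_torsionPointsMap_eq {n : ℤ} (hn : n ≠ 0)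
    (𝒦 : AddSubgroup (galoisCohomology (W.localGaloisModule (ℓ.adicCompletion K)) 1))
    (h𝒦 : ∀ y ∈ 𝒦, n • y = 0) :
    Nat.card (𝒦.comap (galoisCohomology.map (W.torsionPointsMapIntertwining n (ℓ.adicCompletion K)) 1)) =
      Nat.card (W.kummerLocalConditionAt n (ℓ.adicCompletion K)) * Nat.card 𝒦 := by
  haveI : CharZero (ℓ.adicCompletion K) := charZero_adicCompletion ℓ
  have hrange : 𝒦 ≤ (galoisCohomology.map (W.torsionPointsMapIntertwining n (ℓ.adicCompletion K)) 1).range := by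
    intro y hy
    rw [W.range_map_torsionPointsMapIntertwining (ℓ.adicCompletion K) hn]
    exact (Submodule.mem_torsionBy_iff _ _).2 (h𝒦 y hy)
  exact natCard_comap_eq_card_ker_mul _ 𝒦 hrange

omit [NumberField K] [W.IsElliptic] in
/-- The preimage of the trivial subgroup is the Kummer condition itself (`𝓛_ℓ = ker H¹(i_n)`, by definition).
[cite: SilvermanAEC2009, X.§4 (definition of the m-Selmer group)] -/
theorem comap_map_torsionPointsMap_bot (n : ℤ) (E : Type u) [Field E] [Algebra K E] :
    (⊥ : AddSubgroup (galoisCohomology (W.localGaloisModule E) 1)).comap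
        (galoisCohomology.map (W.torsionPointsMapIntertwining n E) 1) = W.kummerLocalConditionAt n E := by
  rw [AddMonoidHom.comap_bot]
  rfl

omit [NumberField K] [W.IsElliptic] in
/-- The Kummer condition lies in every preimage `H¹(i_n)⁻¹(𝒦)`. [cite: SilvermanAEC2009, X.§4 (definition of the m-Selmer group)] -/
theorem kummerLocalConditionAt_le_comap (n : ℤ) (E : Type u) [Field E] [Algebra K E]
    (𝒦 : AddSubgroup (galoisCohomology (W.localGaloisModule E) 1)) :
    W.kummerLocalConditionAt n E ≤ 𝒦.comap (galoisCohomology.map (W.torsionPointsMapIntertwining n E) 1) := by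
  rw [← comap_map_torsionPointsMap_bot W n E]
  exact AddSubgroup.comap_mono bot_le

/-- A finite subgroup of `p`-power order `p^a` with `a ≤ J` is killed by `p^J` (as an integer scalar). [folklore] -/
theorem forall_zsmul_eq_zero_of_natCard_eq_pow {B : Type*} [AddCommGroup B] (𝒦 : AddSubgroup B) {p a J : ℕ}
    (hcard : Nat.card 𝒦 = p ^ a) (haJ : a ≤ J) : ∀ y ∈ 𝒦, ((p ^ J : ℕ) : ℤ) • y = 0 := by
  intro y hy
  have h1 : addOrderOf (⟨y, hy⟩ : 𝒦) ∣ p ^ J :=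
    (addOrderOf_dvd_natCard (⟨y, hy⟩ : 𝒦)).trans (by rw [hcard]; exact pow_dvd_pow p haJ)
  have h2 : (p ^ J) • (⟨y, hy⟩ : 𝒦) = 0 := addOrderOf_dvd_iff_nsmul_eq_zero.1 h1
  rw [natCast_zsmul]
  exact congrArg Subtype.val h2

end LocalIndex


/-! ## §2 No `p`-torsion at one completion ⟹ no `Γ_K`-fixed point in `W[p^∞]` -/

section Fixed

variable {K : Type} [Field K] [NumberField K] (W : WeierstrassCurve K) [W.IsElliptic] (p : ℕ) [hp : Fact p.Prime]
  (v : HeightOneSpectrum (𝓞 K))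

/-- **`W(K_v)[p] = 0 ⟹ W(K̄)[p^∞]` has no `Γ_K`-fixed point** (a fixed `Q` killed by `p^m` is an invariant of the
restricted module `W[p^m]|_{Γ_{K_v}}`, whose invariants have order `#W(K_v)[p^m] = 1`; Milne I §3 `H⁰(K_v, A_n) = A(K_v)_n`,
tree `natCard_invariants_torsion_restrictField`). Route-free re-derivation of t42 GEN 40's lemma (the hypothesis is read
at the completion, so no `W(K)`-points enter). [cite: GreenbergLNM1716, §2 p. 63] [cite: MilneADT2006, I Lemma 3.3] -/
theorem geomPrimaryTorsion_eq_zero_of_fixed_of_adicCompletion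
    (h0 : ∀ P : (W.baseChange (v.adicCompletion K)).toAffine.Point, p • P = 0 → P = 0)
    (Q : W.geomPrimaryTorsion p) (hQ : ∀ σ : absoluteGaloisGroup K, σ • Q = Q) : Q = 0 := by
  let F : Type := v.adicCompletion K
  haveI : CharZero F := charZero_adicCompletion v
  obtain ⟨m, hm⟩ := (AddCommGroup.mem_primaryComponent).1 Q.2
  have hn0 : (p ^ m : ℕ) ≠ 0 := pow_ne_zero m hp.out.ne_zero
  let T : W.geomTorsion ((p ^ m : ℕ) : ℤ) := ⟨(Q : W.geomPoints), (W.mem_geomTorsion_iff _ _).2 (by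
    rw [natCast_zsmul]; exact hm)⟩
  set V := (GaloisRep.restrictField F (W.torsionGaloisModule ((p ^ m : ℕ) : ℤ))).toTopRep.ρ.invariants with hV
  have hT : T ∈ V := by
    rw [hV]
    refine (Representation.mem_invariants _ _).2 fun σ ↦ ?_
    apply Subtype.ext
    have h := congrArg (fun Q : W.geomPrimaryTorsion p ↦ (Q : W.geomPoints)) (hQ (absGaloisRestrict K F σ))
    simp only [primaryComponent.coe_smul] at h
    change (((absGaloisRestrict K F σ) • T : W.geomTorsion ((p ^ m : ℕ) : ℤ)) : W.geomPoints) = (T : W.geomPoints)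
    rw [AddSubgroup.torsionBy.coe_smul]
    exact h
  -- no `p`-torsion ⟹ no `p^m`-torsion in `W(K_v)`
  have hpow : ∀ (k : ℕ) (P : (W.baseChange F).toAffine.Point), p ^ k • P = 0 → P = 0 := by
    intro k
    induction k with
    | zero => intro P hP; simpa using hP
    | succ k ih => intro P hP; rw [pow_succ, mul_smul] at hP; exact h0 P (ih (p • P) hP)
  have hker : (nsmulAddMonoidHom (p ^ m) : (W.baseChange F).toAffine.Point →+ _).ker = ⊥ := by
    rw [eq_bot_iff]
    intro P hP
    exact (AddSubgroup.mem_bot).2 (hpow m P (by simpa using hP))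
  have hcard : Nat.card V = 1 := by
    rw [hV, natCard_invariants_torsion_restrictField W F hn0, hker]
    exact AddSubgroup.card_bot
  haveI : Subsingleton V := (Nat.card_eq_one_iff_unique.mp hcard).1
  have hT0 : (⟨T, hT⟩ : V) = 0 := Subsingleton.elim _ _
  apply Subtype.ext
  rw [ZeroMemClass.coe_zero]
  refine (congrArg (fun x : V ↦ (((x : W.geomTorsion ((p ^ m : ℕ) : ℤ)) : W.geomPoints))) hT0).trans ?_
  simp

end Fixed

/-! ## §3 The Tamagawa product as a finite product; `p^{v_p Tam} = ∏ p^{v_p c_v}` -/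

section Tamagawa

/-- **`Tam(W) = ∏_{v ∈ S_f} c_v`** over any finite set of finite places of `ℚ` containing the bad ones (`c_v = 1` at good `v`,
`localTamagawaNumber_eq_one_of_hasGoodReductionAt_holds`). [cite: SilvermanAEC2009, VII.6 (Thm. 6.1) and remark after Prop. VII.2.1] -/
theorem tamagawaProduct_eq_prod_of_subset (W : WeierstrassCurve ℚ) [W.IsElliptic] (Sf : Finset (HeightOneSpectrum (𝓞 ℚ)))
    (hbad : ∀ v : HeightOneSpectrum (𝓞 ℚ), ¬ W.HasGoodReductionAt v → v ∈ Sf) :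
    W.tamagawaProduct = ∏ v ∈ Sf, (W.baseChange (v.adicCompletion ℚ)).localTamagawaNumber (v.adicCompletionIntegers ℚ) := by
  rw [tamagawaProduct_def]
  refine finprod_eq_prod_of_mulSupport_subset _ fun v hv ↦ ?_
  rw [Finset.mem_coe]
  exact hbad v fun hgood ↦ hv (W.localTamagawaNumber_eq_one_of_hasGoodReductionAt_holds v hgood)

/-- `p^{v_p(∏ f)} = ∏ p^{v_p f}` over a finset of non-zero naturals. [folklore] -/
theorem pow_padicValNat_prod {ι : Type*} (s : Finset ι) (f : ι → ℕ) (hf : ∀ i ∈ s, f i ≠ 0) (p : ℕ) [Fact p.Prime] :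
    p ^ padicValNat p (∏ i ∈ s, f i) = ∏ i ∈ s, p ^ padicValNat p (f i) := by
  induction s using Finset.induction_on with
  | empty => simp
  | insert a s ha ih =>
    rw [Finset.prod_insert ha, Finset.prod_insert ha,
      padicValNat.mul (hf a (Finset.mem_insert_self a s)) (Finset.prod_ne_zero_iff.2 fun i hi ↦
        hf i (Finset.mem_insert_of_mem hi)), pow_add, ih fun i hi ↦ hf i (Finset.mem_insert_of_mem hi)]

/-- **`p^{v_p Tam(W)} = ∏_{v∈S_f} p^{v_p c_v}`** (`S_f` any finite set of finite places containing the bad ones; every `c_v ≠ 0`,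
`localTamagawaNumber_baseChange_ne_zero`). [cite: SilvermanAEC2009, Cor. VII.6.2] -/
theorem pow_padicValNat_tamagawaProduct_eq_prod (W : WeierstrassCurve ℚ) [W.IsElliptic] (p : ℕ) [Fact p.Prime]
    (Sf : Finset (HeightOneSpectrum (𝓞 ℚ))) (hbad : ∀ v : HeightOneSpectrum (𝓞 ℚ), ¬ W.HasGoodReductionAt v → v ∈ Sf) :
    p ^ padicValNat p W.tamagawaProduct =
      ∏ v ∈ Sf, p ^ padicValNat p ((W.baseChange (v.adicCompletion ℚ)).localTamagawaNumber (v.adicCompletionIntegers ℚ)) := by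
  rw [tamagawaProduct_eq_prod_of_subset W Sf hbad]
  exact pow_padicValNat_prod Sf _ (fun v _ ↦ W.localTamagawaNumber_baseChange_ne_zero v) p

end Tamagawa

end FlatBlindTamagawaSplitting

end Summit.BirchSwinnertonDyer.BirchSwinnertonDyer.Theorems

end
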